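import Summits.ResolutionOfSingularities.ResolutionOfSingularities.Theorems.FrobeniusLadderFInjectiveMacaulayficationFaceFPureOfCertificate
import HarnessLib

/-!
# (C5′) THE SINGLETON-CLASS CRITERION: a lone monomial in a `p`-class of `F^(p-1)` certifies Fedder's test at every torus point
# (crux `FInjectiveMacaulayfication`, CN engine in global form — instantiation interface for `CNConeFiModel.cnConeFiModel`'s
# Cartier–Newton hypothesis; CRUX-PLAN v7 (R7.3) «first helper `faceFPure_of_monomial_pcoeff`» of the Q6 typer)

Support file for crux stmt-ResolutionOfSingularities-15315 (`FrobeniusLadder.FInjectiveMacaulayfication`), chain w45a,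
seat res-L1-w45a-stub-3 (Q6CN typer by fallback, R7.3). [OURS · L1 W4.5a] — NOT a statement of the manuscript; AI-written, weaker than
expert review.

* `fedder_of_aeval_expand_ne_zero` — **the core of (C5) without a certificate**: if `F^(p-1) = Σ_α ψ_p(c_α)·y^α` over the reduced
  exponents and some `ψ_p(c_α)` does not vanish at `b ∈ Kⁿ` (ANY `b`, any field `K ⊇ k`), then `(F ⊗ K)^(p-1) ∉ ((yᵢ − bᵢ)^p)`
  (the shift/monomial-ideal/Frobenius-twist argument of `FaceFPureOfCertificate`, which needed neither `bᵢ ≠ 0` nor `F(b) = 0`);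
* `expand_monomial_mul_monomial_cls` — `ψ_p(y^(γ div p)) · y^(γ mod p) = y^γ`;
* `faceFPure_of_monomial_pcoeff` — **SCRIPT-FRIENDLY SINGLETON-CLASS CRITERION** (tri-1 F12′ / idea-2 §(7)): from an explicit expansion
  `F^(p-1) = C u · y^γ₀ + Σ_(γ ∈ L) C a_γ · y^γ` (provable by `ring`/`simp` from a script's output) with `u ≠ 0` and the DECIDABLE class
  condition `∀ γ ∈ L, ∃ i, γ i % p ≠ γ₀ i % p`, Fedder's test holds for `F ⊗ K` at every point of the torus `(K×)ⁿ` of every field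
  `K ⊇ k` — i.e. the `hCN` binder of `cnConeFiModel` for this face, with the hypothesis `F(b) = 0` not even needed.

No definitions, no named facts; glue over (C5)'s helper lemmas. [folklore]
-/

-- single-problem summit: the doubled namespace component is forced
set_option linter.dupNamespace false

noncomputable section

namespace Summit.ResolutionOfSingularities.ResolutionOfSingularities.Theorems.FInjectiveMacaulayfication.FaceFPureOfMonomialPCoeff

open Summit.ResolutionOfSingularities.ResolutionOfSingularities.Theorems.FInjectiveMacaulayfication
open FaceFPureOfCertificate

/-! ## The core of (C5), certificate-free -/

/-- **Fedder's test from ONE non-vanishing `p`-coefficient**: if `F^(p-1) = Σ_α ψ_p(c_α)·y^α` (reduced `α`) and `ψ_p(c_α)(b) ≠ 0`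
for some `α`, then `(F ⊗ K)^(p-1) ∉ ((yᵢ − bᵢ)^p)`. [folklore] -/
theorem fedder_of_aeval_expand_ne_zero (p : ℕ) [Fact p.Prime] {k : Type} [Field k] [CharP k p] {n : ℕ}
    (F : MvPolynomial (Fin n) k) (c : (Fin n → Fin p) → MvPolynomial (Fin n) k)
    (hF : F ^ (p - 1) = ∑ α : Fin n → Fin p, MvPolynomial.expand p (c α) *
      MvPolynomial.monomial (Finsupp.equivFunOnFinite.symm fun j => ((α j : ℕ))) 1)
    {K : Type} [Field K] [Algebra k K] (b : Fin n → K)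
    (hex : ∃ α : Fin n → Fin p, MvPolynomial.aeval b (MvPolynomial.expand p (c α)) ≠ 0) :
    (MvPolynomial.map (algebraMap k K) F) ^ (p - 1) ∉
      Ideal.span (Set.range fun i : Fin n => (MvPolynomial.X i - MvPolynomial.C (b i)) ^ p) := by
  intro hmem
  classical
  have hp : 0 < p := (Fact.out : p.Prime).pos
  haveI : CharP K p := charP_of_injective_algebraMap (algebraMap k K).injective p
  haveI : CharP (MvPolynomial (Fin n) K) p := charP_of_injective_algebraMap (MvPolynomial.C_injective (Fin n) K) p
  obtain ⟨α₀, hα₀⟩ := hex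
  -- the split form of `(F ⊗ K)^(p-1)`
  have hG : (MvPolynomial.map (algebraMap k K) F) ^ (p - 1) = ∑ α : Fin n → Fin p,
      MvPolynomial.expand p (MvPolynomial.map (algebraMap k K) (c α)) *
        MvPolynomial.monomial (Finsupp.equivFunOnFinite.symm fun j => ((α j : ℕ))) (1 : K) := by
    rw [← map_pow, hF, map_sum]
    refine Finset.sum_congr rfl fun α _ => ?_
    rw [map_mul, MvPolynomial.map_expand, MvPolynomial.map_monomial, map_one]
  -- shift `τ : yᵢ ↦ yᵢ + bᵢ`: `τ (F ⊗ K)^(p-1) ∈ (yᵢ^p)`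
  have hτJ : MvPolynomial.aeval (fun i : Fin n => (MvPolynomial.X i : MvPolynomial (Fin n) K) + MvPolynomial.C (b i))
      ((MvPolynomial.map (algebraMap k K) F) ^ (p - 1)) ∈
      Ideal.span (Set.range fun i : Fin n => (MvPolynomial.X i : MvPolynomial (Fin n) K) ^ p) := by
    have h1 := Ideal.mem_map_of_mem (MvPolynomial.aeval (R := K)
      (fun i : Fin n => (MvPolynomial.X i : MvPolynomial (Fin n) K) + MvPolynomial.C (b i))).toRingHom hmem
    rw [Ideal.map_span, ← Set.range_comp] at h1
    have h2 : ((MvPolynomial.aeval (R := K)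
        (fun i : Fin n => (MvPolynomial.X i : MvPolynomial (Fin n) K) + MvPolynomial.C (b i))).toRingHom ∘
        fun i : Fin n => ((MvPolynomial.X i : MvPolynomial (Fin n) K) - MvPolynomial.C (b i)) ^ p) =
        fun i : Fin n => (MvPolynomial.X i : MvPolynomial (Fin n) K) ^ p := by
      funext i
      simp only [Function.comp_apply, AlgHom.toRingHom_eq_coe, RingHom.coe_coe, map_pow, map_sub, MvPolynomial.aeval_X,
        MvPolynomial.aeval_C, MvPolynomial.algebraMap_eq, add_sub_cancel_right]
    rw [h2] at h1
    exact h1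
  -- the scalars `s_α = c_α(b^p)`
  set s : (Fin n → Fin p) → K := fun α => MvPolynomial.constantCoeff (MvPolynomial.aeval
    (fun i : Fin n => (MvPolynomial.X i : MvPolynomial (Fin n) K) + MvPolynomial.C (b i ^ p))
      (MvPolynomial.map (algebraMap k K) (c α))) with hs_def
  -- `P := Σ_α C(s_α) ∏ (yⱼ + bⱼ)^(αⱼ)` lies in `(yᵢ^p)`
  have hP : ∑ α : Fin n → Fin p, MvPolynomial.C (s α) *
      ∏ j : Fin n, ((MvPolynomial.X j : MvPolynomial (Fin n) K) + MvPolynomial.C (b j)) ^ ((α j : ℕ)) ∈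
      Ideal.span (Set.range fun i : Fin n => (MvPolynomial.X i : MvPolynomial (Fin n) K) ^ p) := by
    rw [hG, map_sum] at hτJ
    have hdiff : ∑ α : Fin n → Fin p, (MvPolynomial.aeval
        (fun i : Fin n => (MvPolynomial.X i : MvPolynomial (Fin n) K) + MvPolynomial.C (b i))
        (MvPolynomial.expand p (MvPolynomial.map (algebraMap k K) (c α)) *
          MvPolynomial.monomial (Finsupp.equivFunOnFinite.symm fun j => ((α j : ℕ))) (1 : K)) -
        MvPolynomial.C (s α) * ∏ j : Fin n, ((MvPolynomial.X j : MvPolynomial (Fin n) K) + MvPolynomial.C (b j)) ^ ((α j : ℕ))) ∈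
        Ideal.span (Set.range fun i : Fin n => (MvPolynomial.X i : MvPolynomial (Fin n) K) ^ p) := by
      refine Ideal.sum_mem _ fun α _ => ?_
      have hmon : MvPolynomial.aeval (fun i : Fin n => (MvPolynomial.X i : MvPolynomial (Fin n) K) + MvPolynomial.C (b i))
          (MvPolynomial.monomial (Finsupp.equivFunOnFinite.symm fun j => ((α j : ℕ))) (1 : K)) =
          ∏ j : Fin n, ((MvPolynomial.X j : MvPolynomial (Fin n) K) + MvPolynomial.C (b j)) ^ ((α j : ℕ)) := by
        rw [MvPolynomial.aeval_monomial, map_one, one_mul, Finsupp.prod_fintype _ _ fun i => pow_zero _]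
        simp only [Finsupp.coe_equivFunOnFinite_symm]
      rw [map_mul, hmon, aeval_shift_expand, ← sub_mul]
      refine Ideal.mul_mem_right _ _ ?_
      exact expand_sub_C_mem_span_X_pow p (MvPolynomial.aeval
        (fun i : Fin n => (MvPolynomial.X i : MvPolynomial (Fin n) K) + MvPolynomial.C (b i ^ p))
          (MvPolynomial.map (algebraMap k K) (c α)))
    have h4 := Ideal.sub_mem _ hτJ hdiff
    rwa [← Finset.sum_sub_distrib, Finset.sum_congr rfl fun α _ => sub_sub_cancel _ _] at h4
  -- all `yᵢ`-degrees of `P` are `< p`, so `P = 0`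
  have hP0 : ∑ α : Fin n → Fin p, MvPolynomial.C (s α) *
      ∏ j : Fin n, ((MvPolynomial.X j : MvPolynomial (Fin n) K) + MvPolynomial.C (b j)) ^ ((α j : ℕ)) = 0 := by
    refine eq_zero_of_mem_of_degreeOf_lt p hp hP fun i => ?_
    refine lt_of_le_of_lt (MvPolynomial.degreeOf_sum_le i _ _) ?_
    refine (Finset.sup_lt_iff hp).mpr fun α _ => ?_
    refine lt_of_le_of_lt (MvPolynomial.degreeOf_mul_le i _ _) ?_
    rw [MvPolynomial.degreeOf_C, zero_add]
    exact lt_of_le_of_lt (degreeOf_prod_shift_pow_le b (fun j => ((α j : ℕ))) i) (α i).is_lt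
  -- shift back: `Σ_α C(s_α) y^α = 0`, so every `s_α = 0`
  have hH : ∑ α : Fin n → Fin p, MvPolynomial.C (s α) *
      MvPolynomial.monomial (Finsupp.equivFunOnFinite.symm fun j => ((α j : ℕ))) (1 : K) = 0 := by
    have h5 := congrArg (MvPolynomial.aeval
      (fun i : Fin n => (MvPolynomial.X i : MvPolynomial (Fin n) K) - MvPolynomial.C (b i))) hP0
    rw [map_zero, map_sum] at h5
    rw [← h5]
    refine Finset.sum_congr rfl fun α _ => ?_
    rw [map_mul, MvPolynomial.aeval_C, MvPolynomial.algebraMap_eq, map_prod]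
    congr 1
    rw [MvPolynomial.monomial_eq, MvPolynomial.C_1, one_mul, Finsupp.prod_fintype _ _ fun i => pow_zero _]
    refine Finset.prod_congr rfl fun j _ => ?_
    rw [map_pow, map_add, MvPolynomial.aeval_X, MvPolynomial.aeval_C, MvPolynomial.algebraMap_eq, sub_add_cancel]
    simp only [Finsupp.coe_equivFunOnFinite_symm]
  have hs0 := eq_zero_of_sum_C_mul_monomial_eq_zero p s hH α₀
  -- but `s_{α₀} = c_{α₀}(b^p) = ψ_p(c_{α₀})(b) ≠ 0`
  apply hα₀
  rw [MvPolynomial.aeval_expand]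
  rw [hs_def] at hs0
  simp only at hs0
  rw [constantCoeff_aeval_shift, MvPolynomial.eval_map] at hs0
  rw [← hs0]
  rfl

/-! ## The singleton-class criterion -/

/-- `ψ_p(y^(γ div p)) · y^(γ mod p) = y^γ`. [folklore] -/
theorem expand_monomial_mul_monomial_cls {R : Type} [CommSemiring R] {n : ℕ} (p : ℕ) (hp : 0 < p) (γ : Fin n →₀ ℕ) :
    MvPolynomial.expand p (MvPolynomial.monomial (Finsupp.equivFunOnFinite.symm fun j => γ j / p) (1 : R)) *
      MvPolynomial.monomial (Finsupp.equivFunOnFinite.symm fun j =>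
        (((⟨γ j % p, Nat.mod_lt _ hp⟩ : Fin p) : ℕ))) 1 =
      MvPolynomial.monomial γ 1 := by
  have hexp : p • (Finsupp.equivFunOnFinite.symm fun j => γ j / p : Fin n →₀ ℕ) +
      (Finsupp.equivFunOnFinite.symm fun j => (((⟨γ j % p, Nat.mod_lt _ hp⟩ : Fin p) : ℕ)) : Fin n →₀ ℕ) = γ := by
    ext j
    rw [Finsupp.add_apply, Finsupp.smul_apply, Finsupp.coe_equivFunOnFinite_symm, Finsupp.coe_equivFunOnFinite_symm,
      smul_eq_mul]
    exact Nat.div_add_mod (γ j) p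
  rw [MvPolynomial.expand_monomial, MvPolynomial.monomial_mul, mul_one, hexp]

/-- **THE SINGLETON-CLASS CRITERION (script-friendly form).** If `F^(p-1) = C u · y^γ₀ + Σ_(γ ∈ L) C a_γ · y^γ` with `u ≠ 0` and
every `γ ∈ L` differs from `γ₀` modulo `p` in some coordinate, then Fedder's test holds for `F ⊗ K` at every point of the torus
`(K×)ⁿ`, for every field `K ⊇ k` (so in particular the Cartier–Newton binder of `CNConeFiModel.cnConeFiModel` for this face).
[folklore] -/
theorem faceFPure_of_monomial_pcoeff (p : ℕ) [Fact p.Prime] {k : Type} [Field k] [CharP k p] {n : ℕ}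
    (F : MvPolynomial (Fin n) k) (u : k) (hu : u ≠ 0) (γ₀ : Fin n →₀ ℕ) (L : Finset (Fin n →₀ ℕ)) (a : (Fin n →₀ ℕ) → k)
    (hF : F ^ (p - 1) = MvPolynomial.C u * MvPolynomial.monomial γ₀ 1 +
      ∑ γ ∈ L, MvPolynomial.C (a γ) * MvPolynomial.monomial γ 1)
    (hL : ∀ γ ∈ L, ∃ i : Fin n, γ i % p ≠ γ₀ i % p) :
    ∀ (K : Type) [Field K] [Algebra k K] (b : Fin n → K), (∀ i, b i ≠ 0) →
      (MvPolynomial.map (algebraMap k K) F) ^ (p - 1) ∉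
        Ideal.span (Set.range fun i : Fin n => (MvPolynomial.X i - MvPolynomial.C (b i)) ^ p) := by
  intro K _ _ b hb
  classical
  have hp : 0 < p := (Fact.out : p.Prime).pos
  -- class and quotient of an exponent
  let cls : (Fin n →₀ ℕ) → (Fin n → Fin p) := fun γ j => ⟨γ j % p, Nat.mod_lt _ hp⟩
  let quo : (Fin n →₀ ℕ) → (Fin n →₀ ℕ) := fun γ => Finsupp.equivFunOnFinite.symm fun j => γ j / p
  have hmon : ∀ γ : Fin n →₀ ℕ, MvPolynomial.expand p (MvPolynomial.monomial (quo γ) (1 : k)) *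
      MvPolynomial.monomial (Finsupp.equivFunOnFinite.symm fun j => ((cls γ j : ℕ))) 1 = MvPolynomial.monomial γ 1 :=
    fun γ => expand_monomial_mul_monomial_cls p hp γ
  -- the `p`-coefficient polynomials
  let c : (Fin n → Fin p) → MvPolynomial (Fin n) k := fun α =>
    (if cls γ₀ = α then MvPolynomial.C u * MvPolynomial.monomial (quo γ₀) 1 else 0) +
      ∑ γ ∈ L with cls γ = α, MvPolynomial.C (a γ) * MvPolynomial.monomial (quo γ) 1
  have hdec : F ^ (p - 1) = ∑ α : Fin n → Fin p, MvPolynomial.expand p (c α) *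
      MvPolynomial.monomial (Finsupp.equivFunOnFinite.symm fun j => ((α j : ℕ))) 1 := by
    rw [hF]
    have h1 : ∀ α : Fin n → Fin p, MvPolynomial.expand p (c α) *
        MvPolynomial.monomial (Finsupp.equivFunOnFinite.symm fun j => ((α j : ℕ))) (1 : k) =
        (if cls γ₀ = α then MvPolynomial.C u * MvPolynomial.monomial γ₀ 1 else 0) +
          ∑ γ ∈ L with cls γ = α, MvPolynomial.C (a γ) * MvPolynomial.monomial γ 1 := by
      intro α
      simp only [c, map_add, map_sum, add_mul, Finset.sum_mul]
      congr 1
      · split_ifs with h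
        · subst h
          rw [map_mul, MvPolynomial.expand_C, mul_assoc, hmon]
        · rw [map_zero, zero_mul]
      · refine Finset.sum_congr rfl fun γ hγ => ?_
        rw [Finset.mem_filter] at hγ
        rw [map_mul, MvPolynomial.expand_C, mul_assoc, ← hγ.2, hmon]
    simp only [h1, Finset.sum_add_distrib]
    congr 1
    · rw [Finset.sum_ite_eq Finset.univ (cls γ₀), if_pos (Finset.mem_univ _)]
    · exact (Finset.sum_fiberwise L cls fun γ => MvPolynomial.C (a γ) * MvPolynomial.monomial γ (1 : k)).symm
  refine fedder_of_aeval_expand_ne_zero p F c hdec b ⟨cls γ₀, ?_⟩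
  -- the class of `γ₀` is a singleton in the expansion: `ψ_p(c_{cls γ₀})(b) = u · b^(p • quo γ₀) ≠ 0`
  have hempty : (L.filter fun γ => cls γ = cls γ₀) = ∅ := by
    refine Finset.filter_eq_empty_iff.mpr fun γ hγ h => ?_
    obtain ⟨i, hi⟩ := hL γ hγ
    exact hi (by simpa [cls] using congrArg (fun f : Fin n → Fin p => ((f i : ℕ))) h)
  have hc0 : c (cls γ₀) = MvPolynomial.C u * MvPolynomial.monomial (quo γ₀) 1 := by
    change (if cls γ₀ = cls γ₀ then _ else _) + _ = _
    rw [if_pos rfl, hempty, Finset.sum_empty, add_zero]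
  rw [hc0, map_mul, MvPolynomial.expand_C, MvPolynomial.expand_monomial, map_mul, MvPolynomial.aeval_C,
    MvPolynomial.aeval_monomial, map_one, one_mul]
  refine mul_ne_zero ((map_ne_zero_iff _ (algebraMap k K).injective).mpr hu) ?_
  rw [Finsupp.prod]
  exact Finset.prod_ne_zero_iff.mpr fun i _ => pow_ne_zero _ (hb i)

end Summit.ResolutionOfSingularities.ResolutionOfSingularities.Theorems.FInjectiveMacaulayfication.FaceFPureOfMonomialPCoeff

end
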